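import Mathlib
import HarnessLib
import Summits.HodgeConjecture.HodgeConjecture.Theorems.EightfoldBlochSeedsBlochSpreadEightFourFibreCodimLocal
import Literature.AlgebraicGeometry.Resolution.MaximalContact
import Literature.AlgebraicGeometry.Motives.FamiliesVHS

/-!
# The relative-class input `(RC′)` of the line `bloch-lifts-fulton` from a SUPPORTED CLASS WITH NON-ZERO
# CENTRAL RESTRICTION `(SC)` (crux `BlochSpreadEightFour`, stmt-HodgeConjecture-18884, stub `stub_fultonSpecialises`)

HONEST FRAMING: helper file; no stub is closed and nothing here proves `BlochSpreadEightFour`, rung H2,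
HC_AV or HC. It assembles the proved chain (F3) `…FultonSupportStep`, (F4) `…FlatFamilyFibreCodim`,
(F4′) `…FlatFamilyComponents`, capstone `…FibreCodimLocal` into the implication

  `(SC) ⟹ (RC′)`,

where `(RC′)` is the Zariski-local relative-class input of
`BlochSpreadEightFour_of_blochLifts_of_relativeClassNear` (`…OfRelativeClassNear`) and

  `(SC)`: for `g : 𝒳 ⟶ V` a smooth projective family of relative dimension `n` over a smooth `V`, `0 < p`,
  `ι : 𝒲 ↪ 𝒳` closed and flat over `V`, `v₀ ∈ V(ℂ)` with `𝒲_{v₀}` (as a set `W₀ ⊆ 𝒳_{v₀}`) closed,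
  irreducible, of codimension `≥ p` everywhere and `= p` somewhere: there is a global class
  `Γ ∈ H²ᵖ(𝒳(ℂ); ℂ)` SUPPORTED ON `ι(𝒲)` (`classesSupportedOn`) whose restriction to `𝒳_{v₀}` is non-zero
  — classically the cycle class `cl(𝒲)` of the flat family (Fulton 1998 §19.1 eq. (1): a cycle class is
  supported on the cycle; Prop. 10.1 (a) + Lemma 19.1.1: `cl(𝒲)|_{X₀} = m · cl(W₀) ≠ 0`).

So the Fulton-side debt of the line is exactly `(SC)` = (F1) + (F5b) of the gap inventory: a global class
supported on a flat family of codimension-`p` subschemes of a smooth quasi-projective total space, with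
non-zero restriction to one (irreducible, reduced) fibre. The instances needed by the capstone are derived
here from the binders of `(RC′)`: a smooth projective family is flat and universally closed; `V`, `𝒳`, `𝒲`
are locally Noetherian (locally of finite type over `ℂ`); `𝒳` is smooth over `ℂ`, hence regular
(`Resolution.Scheme.isRegular_of_smooth_over_field`); and `W₀ = 𝒳_{v₀} ∩ ι(𝒲)` (`Scheme.Pullback.range_snd`).

References: [Fulton1998] §10.1 Prop. 10.1 (a), §19.1 eq. (1) and Lemma 19.1.1, §19.2 Cor. 19.2 (b);
[Hartshorne1977] III Prop. 9.5, III.10 (smooth ⇒ flat); [GortzWedhorn2020] Lemma 6.26 (smooth over a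
field ⇒ regular).
-/

-- every declaration of this problem lives in `Summit.HodgeConjecture.HodgeConjecture.…` (summit = sub-problem)
set_option linter.dupNamespace false

noncomputable section

open CategoryTheory CategoryTheory.Limits AlgebraicGeometry Order
open Literature.AlgebraicGeometry.Motives Literature.AlgebraicGeometry.HodgeTheory
open Literature.AlgebraicGeometry.Resolution

namespace Summit.HodgeConjecture.HodgeConjecture.Theorems

/-- **The total space of a smooth projective family over a smooth base has regular local rings**
(smooth over `ℂ` — composition of smooth morphisms — hence regular, Görtz–Wedhorn Lemma 6.26).
[cite: GortzWedhorn2020, Lemma 6.26 (p. 196)] -/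
theorem isRegularLocalRing_stalk_of_isSmoothProjectiveFamily {𝒳 V : SchemeOver ℂ} {g : 𝒳 ⟶ V} {n : ℕ}
    (hg : IsSmoothProjectiveFamily g n) [AlgebraicGeometry.Smooth V.hom] (x : 𝒳.left) :
    IsRegularLocalRing (𝒳.left.presheaf.stalk x) := by
  letI : 𝒳.left.Over (Spec (.of ℂ)) := ⟨𝒳.hom⟩
  haveI : AlgebraicGeometry.Smooth (𝒳.left ↘ Spec (.of ℂ)) := by
    change AlgebraicGeometry.Smooth 𝒳.hom
    rw [← Over.w g]
    haveI := hg.smooth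
    infer_instance
  exact Scheme.isRegular_of_smooth_over_field ℂ 𝒳.left x

/-- **`(SC) ⟹ (RC′)`**: a global class supported on the flat family with non-zero central restriction is a
relative class in the sense of `(RC′)` — its fibre restrictions are algebraic over the Zariski-open
neighbourhood of `v₀` produced by `exists_isOpen_forall_map_fiberι_mem_algebraicClasses_of_flat_family`,
and its central restriction is supported on `W₀ = 𝒳_{v₀} ∩ ι(𝒲)` (pull-back respects supports).
[cite: Fulton1998, §10.1 Prop. 10.1 (a); §19.1 eq. (1) and Lemma 19.1.1] [cite: Hartshorne1977, III Prop. 9.5] -/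
theorem relativeClassNear_of_supportedClass
    (hS : ∀ ⦃n p : ℕ⦄ ⦃𝒳 V : SchemeOver ℂ⦄ (g : 𝒳 ⟶ V), 0 < p → IsSmoothProjectiveFamily g n →
      AlgebraicGeometry.Smooth V.hom →
      ∀ (𝒲 : Scheme) (ι : 𝒲 ⟶ 𝒳.left), IsClosedImmersion ι → Flat (ι ≫ g.left) →
      ∀ (v₀ : ComplexPoints V) (W₀ : Set (fiberOver g v₀).left), IsClosed W₀ → IsIrreducible W₀ →
      Set.range (pullback.snd ι (fiberι g v₀).left).base = W₀ →
      (∀ z ∈ W₀, (p : ℕ∞) ≤ Order.coheight z) → (∃ z ∈ W₀, Order.coheight z = p) →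
      ∃ Γ : complexBetti 𝒳 (2 * p),
        Γ ∈ classesSupportedOn 𝒳 (Set.range ι.base) (2 * p) ∧
        complexBetti.map (fiberι g v₀) (2 * p) Γ ≠ 0) :
    ∀ ⦃n p : ℕ⦄ ⦃𝒳 V : SchemeOver ℂ⦄ (g : 𝒳 ⟶ V), 0 < p → IsSmoothProjectiveFamily g n →
      AlgebraicGeometry.Smooth V.hom →
      ∀ (𝒲 : Scheme) (ι : 𝒲 ⟶ 𝒳.left), IsClosedImmersion ι → Flat (ι ≫ g.left) →
      ∀ (v₀ : ComplexPoints V) (W₀ : Set (fiberOver g v₀).left), IsClosed W₀ → IsIrreducible W₀ →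
      Set.range (pullback.snd ι (fiberι g v₀).left).base = W₀ →
      (∀ z ∈ W₀, (p : ℕ∞) ≤ Order.coheight z) → (∃ z ∈ W₀, Order.coheight z = p) →
      ∃ (Γ : complexBetti 𝒳 (2 * p)) (U₁ : Set V.left), IsOpen U₁ ∧ v₀.pt ∈ U₁ ∧
        (∀ t : ComplexPoints V, t.pt ∈ U₁ →
          complexBetti.map (fiberι g t) (2 * p) Γ ∈ algebraicClasses (fiberOver g t) p) ∧
        complexBetti.map (fiberι g v₀) (2 * p) Γ ∈ classesSupportedOn (fiberOver g v₀) W₀ (2 * p) ∧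
        complexBetti.map (fiberι g v₀) (2 * p) Γ ≠ 0 := by
  intro n p 𝒳 V g hp hg hV 𝒲 ι hι hflat v₀ W₀ hW₀ hirr hrange hcodim hz
  obtain ⟨Γ, hΓ, hΓ0⟩ := hS g hp hg hV 𝒲 ι hι hflat v₀ W₀ hW₀ hirr hrange hcodim hz
  haveI := hι
  haveI := hflat
  haveI := hV
  haveI := hg.smooth
  haveI : UniversallyClosed g.left := by haveI := hg.isProper; infer_instance
  haveI : IsLocallyNoetherian V.left := LocallyOfFiniteType.isLocallyNoetherian V.hom
  haveI : IsLocallyNoetherian 𝒳.left := LocallyOfFiniteType.isLocallyNoetherian g.left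
  haveI : IsLocallyNoetherian 𝒲 := LocallyOfFiniteType.isLocallyNoetherian ι
  have hXreg : ∀ x : 𝒳.left, g.left.base x = v₀.pt → IsRegularLocalRing (𝒳.left.presheaf.stalk x) :=
    fun x _ => isRegularLocalRing_stalk_of_isSmoothProjectiveFamily hg x
  have hW₀eq : W₀ = (fiberι g v₀).left.base ⁻¹' Set.range ι.base := by
    rw [← hrange, Scheme.Pullback.range_snd]
  have hcodim' : ∀ z : (fiberOver g v₀).left,
      (fiberι g v₀).left.base z ∈ Set.range ι.base → (p : ℕ∞) ≤ coheight z :=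
    fun z hz' => hcodim z (by rw [hW₀eq]; exact hz')
  obtain ⟨U₁, hU₁, hv₀, halg⟩ :=
    exists_isOpen_forall_map_fiberι_mem_algebraicClasses_of_flat_family g ι v₀ hXreg hcodim' hΓ
  refine ⟨Γ, U₁, hU₁, hv₀, halg, ?_, hΓ0⟩
  rw [hW₀eq]
  exact mem_classesSupportedOn_map_preimage (fiberι g v₀) hΓ

end Summit.HodgeConjecture.HodgeConjecture.Theorems

end
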